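/-
Copyright (c) 2026 the pub-hodgecm-mathlib formalisation cell (harness21).  Track B «K2-LIT» prover seat hodgecm-mathlib-K2Liu-p02 (g2), item of record
stmt-HodgeConjecture-24832 (hLiu418), LEAD DEAL 2026-09-04T01:42:07Z: socket #31c of unit U5d.  KERNEL module: THEOREMS ONLY (no definition, no named
fact, no instance, no notation, no `sorry`).
-/
import Literature.NumberTheory.K2Lit.SiegelStandardExtension                                  -- ★ `IwasawaDatum.pPart ∕ kPart ∕ modDelta_pPart_*`, `IsDeltaUnimodular`
import Summits.HodgeConjecture.HodgeConjecture.Theorems.K2LiuIwasawaDeltaUnimodular              -- ★ p856285 `IwasawaDatum.modDelta_eq_one_of_mem` (+ ★ #15a `exists_siegelHeight_continuous`)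
import Summits.HodgeConjecture.HodgeConjecture.Theorems.K2LiuSiegelDoubledParabolicReduction      -- ★ `isClosed_siegelDelta` (P_Δ(𝔸) closed)
import Mathlib.Topology.Algebra.ProperAction.Basic                                             -- `QuotientGroup.instT2Space` for a CLOSED subgroup
import HarnessLib

/-!
# hLiu418 / K2_Liu — PAYMENT of socket #31c `sig_K2LiuIwasawaHeightContinuous` (U5d «Z_S», ED. 1 :118): THE IWASAWA HEIGHT IS CONTINUOUS

For EVERY Iwasawa datum `𝒦` (★ `IwasawaDatum`: a compact `K ≤ H(𝔸)` with `H(𝔸) = P_Δ(𝔸)·K`) the height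
`Φ_𝒦(h) := |det_Δ (pPart h)|^{1/2} = modDelta (𝒦.pPart h)` is a POSITIVE CONTINUOUS function on `H(𝔸)` (it is the factor of the standard
extension ★ `stdExtension 𝒦 s₀ φ s = Φ_𝒦^{2(s−s₀)}·φ`, so `s ↦ f_s` has continuous members when `φ` is continuous — consumed by #34 and #32s).

Proof (the typist's road, [Garrett2018 §3.10], [MoeglinWaldspurger1995 I.2.2]): positivity is ★ `modDelta_pos`.  For continuity take the continuous
`P_Δ`-height `Φ₀ > 0` of ★ #15a (`exists_siegelHeight_continuous`, `Φ₀(p x) = modDelta(p)·Φ₀(x)`); `G := Φ₀ / Φ_𝒦` is LEFT `P_Δ(𝔸)`-INVARIANT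
(★ `modDelta_pPart_delta_mul`, every `𝒦` being `Δ`-unimodular by ★ p856285), so `h ↦ G(h⁻¹)` descends to `Ḡ` on the coset space `H(𝔸) ⧸ P_Δ(𝔸)`, which is
HAUSDORFF because `P_Δ(𝔸)` is CLOSED (★ `K2LiuSiegelDoubledParabolicReduction.isClosed_siegelDelta`; Mathlib `QuotientGroup.instT2Space`).  The map
`ρ : K → H(𝔸) ⧸ P_Δ(𝔸)`, `k ↦ ⟦k⁻¹⟧`, is a continuous SURJECTION (Iwasawa) from a compact space, hence a quotient map, and `Ḡ ∘ ρ = Φ₀|_K` (`Φ_𝒦 = 1` on `K`)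
is continuous; so `Ḡ`, `G` and finally `Φ_𝒦 = Φ₀ / G` are continuous.

* §1 `iwasawaHeight_pos`, `iwasawaHeight_delta_mul`, `iwasawaHeight_of_mem_K`, `iwasawaHeight_mul_K`;
* §2 **`continuous_iwasawaHeight`** (closedness of `P_Δ(𝔸)` is ★ `K2LiuSiegelDoubledParabolicReduction.isClosed_siegelDelta`);
* §3 the head **`iwasawaHeightContinuous`** = the socket's statement TOKEN FOR TOKEN (re-tie by import).

HONEST LABEL: HC_CM is proved only modulo the 7 printed citations (2 remaining named inputs: hLiu418 = stmt-HodgeConjecture-24832, h413 =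
stmt-HodgeConjecture-24833) until rung 0 closes; this file is a `--supports stmt-HodgeConjecture-24832` helper and retires nothing by itself.

## References
* [Garrett2018] P. Garrett, *Modern Analysis of Automorphic Forms by Example* (2018), §3.10.
* [MoeglinWaldspurger1995] C. Mœglin, J.-L. Waldspurger, *Spectral decomposition and Eisenstein series* (1995), I.2.2, II.1.5.
* [Tan1999] V. Tan, *Poles of Siegel Eisenstein series on U(n,n)*, Canad. J. Math. 51 (1999), §1.
* [BorelJacquet1979] A. Borel, H. Jacquet, PSPM 33.1 (1979), §4.1.
-/

set_option autoImplicit false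
set_option linter.dupNamespace false

noncomputable section

open NumberField IsDedekindDomain Topology
open scoped Matrix

namespace Summit.HodgeConjecture.HodgeConjecture.Cruxes.HLiu418.K2LiuIwasawaHeightContinuous

open Literature.NumberTheory.Automorphic Literature.NumberTheory.GaloisRepresentations
open Literature.NumberTheory.GelbartRogawski1991 Literature.NumberTheory.GelbartRogawski1991.GRConstruction
open Literature.NumberTheory.K2Lit.SiegelDoubled
open Summit.HodgeConjecture.HodgeConjecture.Cruxes.HLiu418.K2LiuSiegelDeltaHeightExists (exists_siegelHeight_continuous)
open Summit.HodgeConjecture.HodgeConjecture.Cruxes.HLiu418.K2LiuIwasawaDeltaUnimodular (IwasawaDatum.modDelta_eq_one_of_mem)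

variable (L : Type) [Field L] [NumberField L] [IsCMField L]
variable {N M n : ℕ} (e : Fin N × Fin M ≃ Fin n)
  (dV : Fin N → L) (hdV : ∀ i, IsCMField.complexConj L (dV i) = dV i) (hdV0 : ∀ i, dV i ≠ 0)
  (dW : Fin M → L) (hdW : ∀ i, IsCMField.complexConj L (dW i) = dW i) (hdW0 : ∀ i, dW i ≠ 0)

/-! ## §1 The Iwasawa height `Φ_𝒦(h) = |det_Δ (pPart h)|^{1/2}`: algebra -/

variable (𝒦 : IwasawaDatum L e dV hdV dW hdW)

/-- `Φ_𝒦 > 0`. [cite: Tan1999, §1] -/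
theorem iwasawaHeight_pos (h : HA L e dV hdV dW hdW) : 0 < modDelta L e dV hdV dW hdW (𝒦.pPart h) :=
  modDelta_pos L e dV hdV dW hdW _

include hdV0 hdW0 in
/-- `Φ_𝒦(p h) = modDelta(p) · Φ_𝒦(h)` for `p ∈ P_Δ(𝔸)` (every `𝒦` is `Δ`-unimodular, ★ p856285). [cite: Tan1999, §1] [cite: MoeglinWaldspurger1995, II.1.5] -/
theorem iwasawaHeight_delta_mul {p : HA L e dV hdV dW hdW} (hp : IsSiegelDelta L e dV hdV dW hdW p) (h : HA L e dV hdV dW hdW) :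
    modDelta L e dV hdV dW hdW (𝒦.pPart (p * h)) = modDelta L e dV hdV dW hdW p * modDelta L e dV hdV dW hdW (𝒦.pPart h) :=
  IwasawaDatum.modDelta_pPart_delta_mul (IwasawaDatum.modDelta_eq_one_of_mem L e dV hdV hdV0 dW hdW hdW0 𝒦) hp h

include hdV0 hdW0 in
/-- `Φ_𝒦(k) = 1` for `k ∈ K`. [cite: Tan1999, §1] -/
theorem iwasawaHeight_of_mem_K {k : HA L e dV hdV dW hdW} (hk : k ∈ 𝒦.K) : modDelta L e dV hdV dW hdW (𝒦.pPart k) = 1 :=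
  IwasawaDatum.modDelta_pPart_of_mem_K (IwasawaDatum.modDelta_eq_one_of_mem L e dV hdV hdV0 dW hdW hdW0 𝒦) hk

include hdV0 hdW0 in
/-- `Φ_𝒦(h k) = Φ_𝒦(h)` for `k ∈ K`. [cite: Tan1999, §1] -/
theorem iwasawaHeight_mul_K (h : HA L e dV hdV dW hdW) {k : HA L e dV hdV dW hdW} (hk : k ∈ 𝒦.K) :
    modDelta L e dV hdV dW hdW (𝒦.pPart (h * k)) = modDelta L e dV hdV dW hdW (𝒦.pPart h) :=
  IwasawaDatum.modDelta_pPart_mul_K (IwasawaDatum.modDelta_eq_one_of_mem L e dV hdV hdV0 dW hdW hdW0 𝒦) h hk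

/-! ## §2 Continuity -/

include hdV0 hdW0 in
/-- **`Φ_𝒦` IS CONTINUOUS** (compact `K` → Hausdorff `H(𝔸) ⧸ P_Δ(𝔸)` descent against the continuous height of ★ #15a).
[cite: Garrett2018, §3.10] [cite: MoeglinWaldspurger1995, I.2.2] -/
theorem continuous_iwasawaHeight : Continuous fun h : HA L e dV hdV dW hdW => modDelta L e dV hdV dW hdW (𝒦.pPart h) := by
  obtain ⟨Φ, hΦc, hΦpos, hΦP, -, -⟩ := exists_siegelHeight_continuous L e dV hdV dW hdW hdV0 hdW0
  -- notation-free abbreviations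
  set F : HA L e dV hdV dW hdW → ℝ := fun h => modDelta L e dV hdV dW hdW (𝒦.pPart h) with hF
  have hFpos : ∀ h, 0 < F h := fun h => iwasawaHeight_pos L e dV hdV dW hdW 𝒦 h
  -- `G := Φ / F` is left `P_Δ`-invariant
  set G : HA L e dV hdV dW hdW → ℝ := fun h => Φ h / F h with hG
  have hGP : ∀ {p : HA L e dV hdV dW hdW}, IsSiegelDelta L e dV hdV dW hdW p → ∀ h, G (p * h) = G h := by
    intro p hp h
    simp only [hG, hF, hΦP p h hp, iwasawaHeight_delta_mul L e dV hdV hdV0 dW hdW hdW0 𝒦 hp h]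
    rw [mul_div_mul_left _ _ (modDelta_pos L e dV hdV dW hdW p).ne']
  -- `G' h := G h⁻¹` is right `P_Δ`-invariant, hence descends to the coset space `H ⧸ P_Δ`
  let P : Subgroup (HA L e dV hdV dW hdW) := siegelDelta L e dV hdV dW hdW
  haveI : IsClosed ((P : Subgroup (HA L e dV hdV dW hdW)) : Set (HA L e dV hdV dW hdW)) :=
    K2LiuSiegelDoubledParabolicReduction.isClosed_siegelDelta L e dV hdV dW hdW
  have hdesc : ∀ a b : HA L e dV hdV dW hdW, QuotientGroup.leftRel P a b → G a⁻¹ = G b⁻¹ := by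
    intro a b hab
    rw [QuotientGroup.leftRel_apply] at hab
    -- `b⁻¹ = (a⁻¹ b)⁻¹ a⁻¹` with `(a⁻¹ b)⁻¹ ∈ P_Δ`
    have hb : b⁻¹ = (a⁻¹ * b)⁻¹ * a⁻¹ := by group
    rw [hb, hGP (isSiegelDelta_inv L e dV hdV dW hdW ((mem_siegelDelta_iff L e dV hdV dW hdW _).1 hab))]
  let Gbar : HA L e dV hdV dW hdW ⧸ P → ℝ := Quotient.lift (fun a => G a⁻¹) hdesc
  have hGbar_mk : ∀ a : HA L e dV hdV dW hdW, Gbar (QuotientGroup.mk a) = G a⁻¹ := fun a => rfl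
  -- `ρ : K → H ⧸ P_Δ`, `k ↦ ⟦k⁻¹⟧`: continuous surjection from a compact space onto a T2 space, hence a quotient map
  haveI : CompactSpace 𝒦.K := isCompact_iff_compactSpace.1 𝒦.isCompact_K
  let ρ : 𝒦.K → HA L e dV hdV dW hdW ⧸ P := fun k => QuotientGroup.mk ((k : HA L e dV hdV dW hdW)⁻¹)
  have hρc : Continuous ρ := QuotientGroup.continuous_mk.comp (continuous_subtype_val.inv)
  have hρs : Function.Surjective ρ := by
    intro q
    induction q using QuotientGroup.induction_on with
    | H h =>
      obtain ⟨p, k, hp, hk, hpk⟩ := 𝒦.iwasawa h⁻¹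
      refine ⟨⟨k, hk⟩, QuotientGroup.eq.2 ?_⟩
      rw [inv_inv, (mem_siegelDelta_iff L e dV hdV dW hdW _)]
      -- `k · h = p⁻¹`
      have hkh : k * h = p⁻¹ := eq_inv_of_mul_eq_one_right (by rw [← mul_assoc, ← hpk, inv_mul_cancel])
      rw [hkh]
      exact isSiegelDelta_inv L e dV hdV dW hdW hp
  have hρq : IsQuotientMap ρ := (hρc.isClosedMap).isQuotientMap hρc hρs
  -- `Gbar ∘ ρ = Φ|_K` is continuous
  have hcomp : Gbar ∘ ρ = fun k : 𝒦.K => Φ (k : HA L e dV hdV dW hdW) := by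
    funext k
    simp only [Function.comp_apply, ρ, hGbar_mk, inv_inv, hG, hF, iwasawaHeight_of_mem_K L e dV hdV hdV0 dW hdW hdW0 𝒦 k.2, div_one]
  have hGbar_c : Continuous Gbar := hρq.continuous_iff.2 (by rw [hcomp]; exact hΦc.comp continuous_subtype_val)
  -- hence `G = Gbar ∘ mk ∘ inv` is continuous
  have hGc : Continuous G := by
    have : G = Gbar ∘ QuotientGroup.mk ∘ fun h : HA L e dV hdV dW hdW => h⁻¹ := by
      funext h
      simp only [Function.comp_apply, hGbar_mk, inv_inv]
    rw [this]
    exact hGbar_c.comp (QuotientGroup.continuous_mk.comp continuous_inv)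
  -- and `F = Φ / G`
  have hFG : F = fun h => Φ h / G h := by
    funext h
    have hF0 : F h ≠ 0 := (hFpos h).ne'
    have hΦ0 : Φ h ≠ 0 := (hΦpos h).ne'
    simp only [hG, hF] at hF0 ⊢
    field_simp
  rw [hFG]
  exact hΦc.div hGc fun h => div_ne_zero (hΦpos h).ne' (hFpos h).ne'

/-! ## §3 The head: socket #31c TOKEN FOR TOKEN -/

/-- **PAYMENT OF `sig_K2LiuIwasawaHeightContinuous`** (socket #31c of unit U5d «`Z_S`» of the K2_Liu road,
`Cruxes/HLiu418/Lines/K2_Liu_CurveThetaSigs_U5d_ZetaS.lean` ED. 1 :118, TOKEN FOR TOKEN): for every Iwasawa datum `𝒦`, the Iwasawa height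
`h ↦ |det_Δ (pPart h)|^{1/2}` is positive and continuous on `H(𝔸)`. [cite: Garrett2018, §3.10] [cite: MoeglinWaldspurger1995, I.2.2] [cite: Tan1999, §1] -/
theorem iwasawaHeightContinuous :
    ∀ (L : Type) [Field L] [NumberField L] [IsCMField L] {N M n : ℕ} (e : Fin N × Fin M ≃ Fin n)
      (dV : Fin N → L) (hdV : ∀ i, IsCMField.complexConj L (dV i) = dV i) (_hdV0 : ∀ i, dV i ≠ 0)
      (dW : Fin M → L) (hdW : ∀ i, IsCMField.complexConj L (dW i) = dW i) (_hdW0 : ∀ i, dW i ≠ 0)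
      (𝒦 : IwasawaDatum L e dV hdV dW hdW),
      (∀ h : HA L e dV hdV dW hdW, 0 < modDelta L e dV hdV dW hdW (𝒦.pPart h)) ∧
        Continuous fun h : HA L e dV hdV dW hdW => modDelta L e dV hdV dW hdW (𝒦.pPart h) :=
  fun L _ _ _ _ _ _ e dV hdV hdV0 dW hdW hdW0 𝒦 =>
    ⟨iwasawaHeight_pos L e dV hdV dW hdW 𝒦, continuous_iwasawaHeight L e dV hdV hdV0 dW hdW hdW0 𝒦⟩

end Summit.HodgeConjecture.HodgeConjecture.Cruxes.HLiu418.K2LiuIwasawaHeightContinuous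

end
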